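import Literature.Computability.MetaComplexity.McKayMurrayWilliams2019.UniformStreaming
import Mathlib.Algebra.Order.Chebyshev
import HarnessLib

/-!
# One-pass streaming space: the state-counting (fooling-set) lower bound

S. Arora, B. Barak, *Computational Complexity: A Modern Approach*, CUP 2009, §13.2.1,
Lemma 13.5 (the fooling-set method) — in its one-way / averaged (Cauchy–Schwarz) form for the
one-pass streaming algorithms of McKay–Murray–Williams 2019, §2 (the tree's `StreamingAlgorithm`,
`reach`, `RunsInSpace`): the state of a one-pass algorithm after a prefix is all it remembers, so
if prefixes `u g` and suffixes `v g'` (all `u g ++ v g'` of one length `N`) satisfy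
`u g ++ v g ∈ L` for every `g`, then every pair `(g, g')` whose prefixes reach the SAME state has
`u g ++ v g' ∈ L` (`mem_of_reach_eq`); the states reached in space `S N` number at most
`(S N + 1) · 2^{S N}` (`card_image_reach_le`); hence (Cauchy–Schwarz over the fibres of the state
map) **`card_sq_le_of_fooling`**:
`|ι|² ≤ (S N + 1) · 2^{S N} · #{(g, g') | u g ++ v g' ∈ L}`.
Read contrapositively: a diagonal family with few good off-diagonal pairs forces large space.
This is the information-theoretic (communication) half of every streaming space lower bound; it
says nothing about update time.

Theorems only; no definitions, no named facts.

## References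

* S. Arora, B. Barak, *Computational Complexity: A Modern Approach*, Cambridge University Press,
  2009, §13.2.1, Lemma 13.5 [AroraBarakCC2009].
* D. M. McKay, C. D. Murray, R. R. Williams, *Weak lower bounds on resource-bounded compression
  imply strong separations of complexity classes*, STOC 2019, §2 (Streaming Algorithms)
  [McKayMurrayWilliams2019].
-/

noncomputable section

open Finset

namespace Literature.Computability.MetaComplexity.McKayMurrayWilliams2019

open Literature.Computability.MetaComplexity

/-- **The final state factors through the state reached on a prefix**: on `u ++ v` of length
`N`, the final state is the run from `reach A N u` over `v`. [cite: McKayMurrayWilliams2019, §2 (Streaming Algorithms)] -/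
theorem finalState_append (A : StreamingAlgorithm) {N : ℕ} (u v : List Bool)
    (hN : (u ++ v).length = N) : A.finalState (u ++ v) = A.runFrom N (reach A N u) v := by
  simp only [StreamingAlgorithm.finalState, hN, reach, StreamingAlgorithm.runFrom, List.foldl_append]

/-- **Same state after the prefix, same answer**: if `u g ++ v g ∈ L` for all `g` (a diagonal
family of one length `N`) and the prefixes `u g`, `u g'` reach the same state, then
`u g ++ v g' ∈ L`. [cite: AroraBarakCC2009, §13.2.1 Lemma 13.5 (fooling set method, one-way form)] -/
theorem mem_of_reach_eq (A : StreamingAlgorithm) {L : Language Bool} (hD : A.Decides L)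
    {ι : Type*} {N : ℕ} (u v : ι → List Bool) (hN : ∀ g g', (u g ++ v g').length = N)
    (hdiag : ∀ g, u g ++ v g ∈ L) {g g' : ι} (h : reach A N (u g) = reach A N (u g')) :
    u g ++ v g' ∈ L := by
  have hacc : A.Accepts (u g ++ v g') ↔ A.Accepts (u g' ++ v g') := by
    unfold StreamingAlgorithm.Accepts
    rw [hN, hN, finalState_append A _ _ (hN g g'), finalState_append A _ _ (hN g' g'), h]
  exact (hD _).1 (hacc.2 ((hD _).2 (hdiag g')))

/-- **Few states in small space**: the states reached (at input length `N`) on any family of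
prefixes of length `≤ N` number at most `(S N + 1) · 2^{S N}`. [cite: McKayMurrayWilliams2019, §2 (Streaming Algorithms: "working storage of s(n) bits")] -/
theorem card_image_reach_le (A : StreamingAlgorithm) {S : ℕ → ℕ} (hS : RunsInSpace A S)
    {ι : Type*} [DecidableEq ι] {N : ℕ} (s : Finset ι) (u : ι → List Bool)
    (hu : ∀ g, (u g).length ≤ N) :
    (s.image fun g => reach A N (u g)).card ≤ (S N + 1) * 2 ^ S N := by
  classical
  set m := S N with hm
  have hlen : ∀ g, (reach A N (u g)).length ≤ m := fun g => hS N (u g) (hu g)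
  let e : List Bool → Fin (m + 1) × (Fin m → Bool) := fun l =>
    (⟨min l.length m, by omega⟩, fun i => l.getD i false)
  have hinj : Set.InjOn e ↑(s.image fun g => reach A N (u g)) := by
    intro l hl l' hl' h
    rw [coe_image] at hl hl'
    obtain ⟨g, -, rfl⟩ := hl
    obtain ⟨g', -, rfl⟩ := hl'
    have h1 : min (reach A N (u g)).length m = min (reach A N (u g')).length m :=
      congrArg (fun p : Fin (m + 1) × (Fin m → Bool) => (p.1 : ℕ)) h
    rw [min_eq_left (hlen g), min_eq_left (hlen g')] at h1
    have h2 : ∀ i : Fin m, (reach A N (u g)).getD i false = (reach A N (u g')).getD i false :=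
      fun i => congrFun (congrArg Prod.snd h) i
    apply List.ext_getElem h1
    intro i hi hi'
    have := h2 ⟨i, lt_of_lt_of_le hi (hlen g)⟩
    rw [List.getD_eq_getElem?_getD, List.getD_eq_getElem?_getD, List.getElem?_eq_getElem hi,
      List.getElem?_eq_getElem hi', Option.getD_some, Option.getD_some] at this
    exact this
  calc (s.image fun g => reach A N (u g)).card
      = ((s.image fun g => reach A N (u g)).image e).card := (card_image_of_injOn hinj).symm
    _ ≤ (univ : Finset (Fin (m + 1) × (Fin m → Bool))).card := card_le_card (subset_univ _)
    _ = (S N + 1) * 2 ^ S N := by simp [hm]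

open scoped Classical in
/-- **Arora–Barak 2009, Lemma 13.5 (fooling-set / state-counting bound), one-pass averaged
form.** If a one-pass streaming algorithm deciding `L` runs in space `S`, and a family of
prefixes `u g` and suffixes `v g'` — all words `u g ++ v g'` of one length `N` — has every
diagonal word `u g ++ v g` in `L`, then
`|ι|² ≤ (S N + 1) · 2^{S N} · #{(g, g') | u g ++ v g' ∈ L}`:
pairs reaching the same state are good (`mem_of_reach_eq`), there are at most
`(S N + 1) 2^{S N}` states (`card_image_reach_le`), and Cauchy–Schwarz over the fibres of the
state map. [cite: AroraBarakCC2009, §13.2.1 Lemma 13.5 (fooling set method)] -/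
theorem card_sq_le_of_fooling (A : StreamingAlgorithm) {L : Language Bool} (hD : A.Decides L)
    {S : ℕ → ℕ} (hS : RunsInSpace A S) {ι : Type*} [Fintype ι] {N : ℕ} (u v : ι → List Bool)
    (hN : ∀ g g', (u g ++ v g').length = N) (hdiag : ∀ g, u g ++ v g ∈ L) :
    Fintype.card ι ^ 2 ≤
      (S N + 1) * 2 ^ S N * (univ.filter fun p : ι × ι => u p.1 ++ v p.2 ∈ L).card := by
  set good := univ.filter fun p : ι × ι => u p.1 ++ v p.2 ∈ L with hgood
  let σ : ι → List Bool := fun g => reach A N (u g)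
  have hu : ∀ g, (u g).length ≤ N := fun g => by
    have := hN g g; rw [List.length_append] at this; omega
  let img : Finset (List Bool) := univ.image σ
  let fib : List Bool → Finset ι := fun t => univ.filter fun g => σ g = t
  have himg : img.card ≤ (S N + 1) * 2 ^ S N := card_image_reach_le A hS univ u hu
  have hsum : ∑ t ∈ img, (fib t).card = Fintype.card ι := by
    rw [← card_univ, card_eq_sum_card_image σ univ]
  have hpairs : ∑ t ∈ img, (fib t).card ^ 2 ≤ good.card := by
    calc ∑ t ∈ img, (fib t).card ^ 2 = ∑ t ∈ img, (fib t ×ˢ fib t).card := by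
          simp only [sq, card_product]
      _ = (img.biUnion fun t => fib t ×ˢ fib t).card := by
          rw [card_biUnion]
          intro t _ t' _ htt'
          rw [Function.onFun, disjoint_left]
          rintro ⟨a, b⟩ h1 h2
          simp only [fib, mem_product, mem_filter, mem_univ, true_and] at h1 h2
          exact htt' (h1.1.symm.trans h2.1)
      _ ≤ good.card := by
          apply card_le_card
          intro p hp
          simp only [mem_biUnion, mem_product, fib, mem_filter, mem_univ, true_and] at hp
          obtain ⟨t, -, h1, h2⟩ := hp
          rw [hgood, mem_filter]
          exact ⟨mem_univ _, mem_of_reach_eq A hD u v hN hdiag (h1.trans h2.symm)⟩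
  calc Fintype.card ι ^ 2 = (∑ t ∈ img, (fib t).card) ^ 2 := by rw [hsum]
    _ ≤ img.card * ∑ t ∈ img, (fib t).card ^ 2 := sq_sum_le_card_mul_sum_sq
    _ ≤ (S N + 1) * 2 ^ S N * good.card := Nat.mul_le_mul himg hpairs

/-- **Contrapositive, the form lower bounds use**: a diagonal family in `L` of one length `N`
with at most `B` good pairs and `(S N + 1) · 2^{S N} · B < |ι|²` is not decided in space `S`
by `A`. [cite: AroraBarakCC2009, §13.2.1 Lemma 13.5 (fooling set method)] -/
theorem not_decides_of_fooling (A : StreamingAlgorithm) {L : Language Bool} {S : ℕ → ℕ}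
    (hS : RunsInSpace A S) {ι : Type*} [Fintype ι] {N : ℕ} (u v : ι → List Bool)
    (hN : ∀ g g', (u g ++ v g').length = N) (hdiag : ∀ g, u g ++ v g ∈ L) {B : ℕ}
    (hB : ∀ s : Finset (ι × ι), (∀ p ∈ s, u p.1 ++ v p.2 ∈ L) → s.card ≤ B)
    (hlt : (S N + 1) * 2 ^ S N * B < Fintype.card ι ^ 2) : ¬ A.Decides L := by
  classical
  intro hD
  have h := card_sq_le_of_fooling A hD hS u v hN hdiag
  have hgood : (univ.filter fun p : ι × ι => u p.1 ++ v p.2 ∈ L).card ≤ B :=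
    hB _ fun p hp => (mem_filter.1 hp).2
  have := h.trans (Nat.mul_le_mul_left _ hgood)
  omega

end Literature.Computability.MetaComplexity.McKayMurrayWilliams2019
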